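import Literature.AlgebraicGeometry.Frobenioids.Cor411iOfFSMType
import Literature.AlgebraicGeometry.Frobenioids.Thm42AsTypedAllFrobenioids
import Literature.AlgebraicGeometry.Frobenioids.EquivalenceThm34OfThm34ii
import HarnessLib

/-!
# Frobenioids I, Corollary 4.11 (i) AS TYPED in print's generality — NO hypothesis on the base categories
# beyond print's standard type (Def. 3.1 (i)(d))

Mochizuki, *The geometry of Frobenioids I: the general theory*, Kyushu J. Math. **62** (2008)
293–400, kurims text: Cor. 4.11 (i) p. 91, proof p. 92 l. 33 – p. 93 l. 28 [cite: MochizukiFrdI2008, Cor. 4.11 (i) p.91];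
Theorem 3.4 (ii)(iii) p. 62; Theorem 4.2 (i) p. 77.

PROOF-ONLY file (seat abc-iut-L1-t14, lineage row `FrdI:Cor4.11(i)`): the twin of this seat's
`Cor411iOfFSMType.lean` (`PreFrobenioid.cor411i_ofFunctor_of_isOfFSMType`, bases of FSM-type) with the cell's
base hypothesis REPLACED by the now-landed as-printed inputs — Thm. 3.4 (ii) for every pair of Frobenioids
(`FrdI.thm34ii_ofFunctor`, seats abc-iut-L1-t11/t13, 2008 FSMFF wording), Thm. 3.4 (iii) from it
(`FrdI.thm34iii_ofFunctor_of_thm34ii`), Thm. 4.2 (i) for every pair of Frobenioids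
(`FrdI.T42.thm42i_ofFunctor`, seat abc-iut-w4-d105 lineage):

* `FrdI.isDivIdentity_map` — `Ψ` preserves the Div-identity endomorphisms of EVERY object (standard type,
  `Φ_i` perf-factorial): group-like case trivial; otherwise Thm. 4.2 (i) for `Ψ^istr` transported along the
  isotropification square (as in `FrdI.isDivIdentity_map_of_isOfFSMType`);
* `PreFrobenioid.cor411i_ofFunctor` — the typed `(ofFunctor Φ₁ F₁).Cor411i (ofFunctor Φ₂ F₂) Ψ Ψistr` for THE
  restriction `Ψistr` of `Ψ`, for EVERY pair of Frobenioids `C_i → F_{Φ_i}` with perf-factorial `Φ_i` and every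
  equivalence `Ψ`, under `Cor411Setting` only (seat abc-iut-L1-d6's `cor411i_restrict` with its three transports
  discharged).
Together with seat abc-iut-L1-d6's `Cor411AsPrinted.lean` ((ii)(iii)(iv)) this closes Cor. 4.11 (i)–(iv) AS TYPED
with no hypothesis on the bases. No new definitions; nothing of the paper is restated; nothing here is specific to
the abc programme and no side is taken on [IUTchIII] Cor. 3.12.
-/

namespace Literature.AlgebraicGeometry.Frobenioids

open CategoryTheory Opposite

universe w v v' u u'

namespace FrdI

open PreFrobenioid

variable {D₁ : Type u} [Category.{v} D₁] {Φ₁ : D₁ᵒᵖ ⥤ CommMonCat.{w}} {C₁ : Type u'} [Category.{v'} C₁]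
  {D₂ : Type u} [Category.{v} D₂] {Φ₂ : D₂ᵒᵖ ⥤ CommMonCat.{w}} {C₂ : Type u'} [Category.{v'} C₂]
  {F₁ : C₁ ⥤ ElemFrobenioid Φ₁} {F₂ : C₂ ⥤ ElemFrobenioid Φ₂}

set_option backward.isDefEq.respectTransparency false in
/-- **`Ψ` preserves Div-identity endomorphisms — of EVERY object — for every pair of Frobenioids of standard
type with perf-factorial `Φ_i`** (Thm. 4.2 (i), clause 2, beyond isotropic type; no hypothesis on the bases):
`Ψ`, `Ψ⁻¹` preserve group-like objects (Thm. 3.4 (ii), `FrdI.thm34ii_ofFunctor`), so either both `C_i` are of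
group-like type — then every `Φ₂(Base B)` is trivial — or both have non-group-like objects, in which case Thm. 4.2
(i) holds for the restriction `Ψ^istr` to the isotropic parts (`FrdI.T42.thm42i_ofFunctor`; `C_i^istr` of
standard and isotropic, non-group-like type) and transports along `istr₁ ⋙ Ψ^istr ≅ Ψ ⋙ istr₂`, the
isotropification preserving and reflecting Div-identity endomorphisms. [cite: MochizukiFrdI2008, Thm. 4.2 (i) p.77] -/
theorem isDivIdentity_map (hF₁ : IsFrobenioid F₁) (hF₂ : IsFrobenioid F₂)
    (hpf₁ : Objectwise (fun M _ => IsPerfFactorial M) Φ₁) (hpf₂ : Objectwise (fun M _ => IsPerfFactorial M) Φ₂)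
    (hs₁ : (PreFrobenioidData.ofFunctor Φ₁ F₁).IsOfStandardType)
    (hs₂ : (PreFrobenioidData.ofFunctor Φ₂ F₂).IsOfStandardType) (Ψ : C₁ ≌ C₂)
    {A : C₁} (α : A ⟶ A) (hα : IsDivIdentity F₁ α) : IsDivIdentity F₂ (Ψ.functor.map α) := by
  have hq₁ := hs₁.quasiIsotropic
  have hq₂ := hs₂.quasiIsotropic
  -- Thm. 3.4 (ii): group-like objects are preserved by `Ψ` and by `Ψ⁻¹`
  obtain ⟨-, -, hG⟩ := FrdI.thm34ii_ofFunctor hF₁ hF₂ Ψ hq₁ hq₂ hs₁.fsmff hs₂.fsmff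
  obtain ⟨-, -, hG'⟩ := FrdI.thm34ii_ofFunctor hF₂ hF₁ Ψ.symm hq₂ hq₁ hs₂.fsmff hs₁.fsmff
  rcases FrdI.OfPreSteps.groupLike_dichotomy Ψ hG hG' with ⟨-, hG₂⟩ | ⟨⟨N₁, hN₁⟩, ⟨N₂, hN₂⟩⟩
  · -- group-like type: `Φ₂(Base (Ψ A))` is trivial
    refine MonoidHom.ext fun x => ?_
    exact (hG₂.obj (Ψ.functor.obj A) _).trans (hG₂.obj (Ψ.functor.obj A) x).symm
  · -- not of group-like type: Thm. 4.2 (i) for `Ψ^istr`, transported along the isotropification square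
    have hG₁ : ¬ (PreFrobenioidData.ofFunctor Φ₁ F₁).IsOfGroupLikeType := fun h => hN₁ (h.obj N₁)
    have hG₂ : ¬ (PreFrobenioidData.ofFunctor Φ₂ F₂).IsOfGroupLikeType := fun h => hN₂ (h.obj N₂)
    haveI : (isotropicObjects F₂).IsClosedUnderIsomorphisms :=
      ⟨fun e h => IsIsotropic.of_iso hF₂.isPreFrobenioid e.symm h⟩
    let Ψif := Ψ.congrFullSubcategory (FrdI.isotropicObjects_inverseImage hF₁ hq₁ hq₂ Ψ)
    have hI₁ := isFrobenioid_istr hF₁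
    have hI₂ := isFrobenioid_istr hF₂
    have hSI₁ := isOfStandardType_istr hF₁ hs₁
    have hSI₂ := isOfStandardType_istr hF₂ hs₂
    have hGI₁ : ¬ (PreFrobenioidData.ofFunctor Φ₁ (istrFunctor F₁)).IsOfGroupLikeType := fun h =>
      hG₁ (isOfGroupLikeType_of_istr' hF₁ h)
    have hGI₂ : ¬ (PreFrobenioidData.ofFunctor Φ₂ (istrFunctor F₂)).IsOfGroupLikeType := fun h =>
      hG₂ (isOfGroupLikeType_of_istr' hF₂ h)
    have hiI₁ : (PreFrobenioidData.ofFunctor Φ₁ (istrFunctor F₁)).IsOfIsotropicType :=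
      (PreFrobenioidData.ofFunctor_isOfIsotropicType _).mpr isOfIsotropicType_istr
    have hiI₂ : (PreFrobenioidData.ofFunctor Φ₂ (istrFunctor F₂)).IsOfIsotropicType :=
      (PreFrobenioidData.ofFunctor_isOfIsotropicType _).mpr isOfIsotropicType_istr
    have hT : PreFrobenioidData.Thm42Setting (PreFrobenioidData.ofFunctor Φ₁ (istrFunctor F₁))
        (PreFrobenioidData.ofFunctor Φ₂ (istrFunctor F₂)) := ⟨⟨hSI₁, hSI₂⟩, ⟨hiI₁, hiI₂⟩, ⟨hGI₁, hGI₂⟩⟩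
    have hdiI : ∀ (X : Istr F₁) (φ : X ⟶ X), (PreFrobenioidData.ofFunctor Φ₁ (istrFunctor F₁)).IsDivIdentity φ →
        (PreFrobenioidData.ofFunctor Φ₂ (istrFunctor F₂)).IsDivIdentity (Ψif.functor.map φ) :=
      (FrdI.T42.thm42i_ofFunctor Ψif hI₁ hI₂ hpf₁ hpf₂ hT).2.1
    obtain ⟨e⟩ := nonempty_isotropification_comp_iso hF₁ hF₂ hq₁ hq₂ Ψ
    exact FrdI.T42.isDivIdentity_map_of_square (F₁' := istrFunctor F₁) (F₂' := istrFunctor F₂) e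
      (fun X β hβ => isDivIdentity_hullMor hF₁ β hβ) (fun X β hβ => isDivIdentity_of_hullMor hF₂ β hβ)
      (fun X β hβ => (PreFrobenioidData.ofFunctor_isDivIdentity (istrFunctor F₂) _).mp
        (hdiI X β ((PreFrobenioidData.ofFunctor_isDivIdentity (istrFunctor F₁) β).mpr hβ)))
      α hα

end FrdI

namespace PreFrobenioid

variable {D₁ : Type u} [Category.{v} D₁] {Φ₁ : D₁ᵒᵖ ⥤ CommMonCat.{w}} {C₁ : Type u'} [Category.{v'} C₁]
  {D₂ : Type u} [Category.{v} D₂] {Φ₂ : D₂ᵒᵖ ⥤ CommMonCat.{w}} {C₂ : Type u'} [Category.{v'} C₂]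
  {F₁ : C₁ ⥤ ElemFrobenioid Φ₁} {F₂ : C₂ ⥤ ElemFrobenioid Φ₂}

set_option backward.isDefEq.respectTransparency false in
/-- **[FrdI] Cor. 4.11 (i) AS TYPED for EVERY pair of Frobenioids with perf-factorial `Φ_i` and every
equivalence `Ψ`** (no hypothesis on the bases beyond print's standard type): under `Cor411Setting` (`D_i`
Div-slim, `C_i` of standard type, hypothesis (b)) there are THE restriction `Ψ^istr : C₁^istr ⥲ C₂^istr` of `Ψ`
and a `1`-unique `Ψ^un-tr : C₁^un-tr ⥲ C₂^un-tr` `1`-commuting with the projections, both composites rigid — the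
typed `Cor411i` for `Ψ^istr`. Inputs BY NAME: seat abc-iut-L1-d6's `cor411i_restrict`; isotropic objects
`FrdI.isIsotropic_map` (Thm. 3.4 (i)); pull-back morphisms `FrdI.thm34iii_ofFunctor_of_thm34ii` ∘
`FrdI.thm34ii_ofFunctor` (Thm. 3.4 (ii)(iii) as printed); Div-identity endomorphisms `FrdI.isDivIdentity_map`
(Thm. 4.2 (i)). [cite: MochizukiFrdI2008, Cor. 4.11 (i) p.91] -/
theorem cor411i_ofFunctor (hF₁ : IsFrobenioid F₁) (hF₂ : IsFrobenioid F₂)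
    (hpf₁ : Objectwise (fun M _ => IsPerfFactorial M) Φ₁) (hpf₂ : Objectwise (fun M _ => IsPerfFactorial M) Φ₂)
    (Ψ : C₁ ≌ C₂) (hs : (PreFrobenioidData.ofFunctor Φ₁ F₁).Cor411Setting (PreFrobenioidData.ofFunctor Φ₂ F₂) Ψ) :
    ∃ Ψistr : (PreFrobenioidData.ofFunctor Φ₁ F₁).Istr ≌ (PreFrobenioidData.ofFunctor Φ₂ F₂).Istr,
      Ψistr.functor ⋙ (PreFrobenioidData.ofFunctor Φ₂ F₂).istrι =
          (PreFrobenioidData.ofFunctor Φ₁ F₁).istrι ⋙ Ψ.functor ∧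
        (PreFrobenioidData.ofFunctor Φ₁ F₁).Cor411i (PreFrobenioidData.ofFunctor Φ₂ F₂) Ψ Ψistr.functor := by
  have hs₁ := hs.standard.1
  have hs₂ := hs.standard.2
  have hq₁ := hs₁.quasiIsotropic
  have hq₂ := hs₂.quasiIsotropic
  have hB := hs.hypB
  have hB' : (PreFrobenioidData.ofFunctor Φ₂ F₂).HypB (PreFrobenioidData.ofFunctor Φ₁ F₁) Ψ.symm :=
    fun g₂ g₁ => ⟨(hB g₁ g₂).2, (hB g₁ g₂).1⟩
  -- Thm. 3.4 (i): isotropic objects are preserved by `Ψ` and by `Ψ⁻¹`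
  have hiso : ∀ A : C₁, (PreFrobenioidData.ofFunctor Φ₂ F₂).IsIsotropic (Ψ.functor.obj A) ↔
      (PreFrobenioidData.ofFunctor Φ₁ F₁).IsIsotropic A := fun A =>
    ⟨fun h => (PreFrobenioidData.ofFunctor_isIsotropic F₁ A).mpr
        (IsIsotropic.of_iso hF₁.isPreFrobenioid (Ψ.unitIso.app A)
          (FrdI.isIsotropic_map hq₂ hq₁ Ψ.symm ((PreFrobenioidData.ofFunctor_isIsotropic F₂ _).mp h))),
      fun h => (PreFrobenioidData.ofFunctor_isIsotropic F₂ _).mpr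
        (FrdI.isIsotropic_map hq₁ hq₂ Ψ ((PreFrobenioidData.ofFunctor_isIsotropic F₁ A).mp h))⟩
  -- Thm. 3.4 (ii) as printed, for `Ψ` and `Ψ⁻¹`; Thm. 3.4 (iii) from it: pull-back morphisms are preserved
  have h2 := FrdI.thm34ii_ofFunctor hF₁ hF₂ Ψ
  have h2' := FrdI.thm34ii_ofFunctor hF₂ hF₁ Ψ.symm
  have h3 := FrdI.thm34iii_ofFunctor_of_thm34ii hF₁ hF₂ Ψ h2 h2' hs₁ hs₂ hB
  have h3' := FrdI.thm34iii_ofFunctor_of_thm34ii hF₂ hF₁ Ψ.symm h2' (FrdI.thm34ii_ofFunctor hF₁ hF₂ _) hs₂ hs₁ hB'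
  -- Thm. 4.2 (i): Div-identity endomorphisms are preserved by `Ψ` and by `Ψ⁻¹`
  have hdi : ∀ (A : C₁) (φ : A ⟶ A), (PreFrobenioidData.ofFunctor Φ₁ F₁).IsDivIdentity φ →
      (PreFrobenioidData.ofFunctor Φ₂ F₂).IsDivIdentity (Ψ.functor.map φ) := fun A φ hφ =>
    (PreFrobenioidData.ofFunctor_isDivIdentity F₂ _).mpr
      (FrdI.isDivIdentity_map hF₁ hF₂ hpf₁ hpf₂ hs₁ hs₂ Ψ φ ((PreFrobenioidData.ofFunctor_isDivIdentity F₁ φ).mp hφ))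
  have hdi' : ∀ (B : C₂) (φ : B ⟶ B), (PreFrobenioidData.ofFunctor Φ₂ F₂).IsDivIdentity φ →
      (PreFrobenioidData.ofFunctor Φ₁ F₁).IsDivIdentity (Ψ.inverse.map φ) := fun B φ hφ =>
    (PreFrobenioidData.ofFunctor_isDivIdentity F₁ _).mpr
      (FrdI.isDivIdentity_map hF₂ hF₁ hpf₂ hpf₁ hs₂ hs₁ Ψ.symm φ
        ((PreFrobenioidData.ofFunctor_isDivIdentity F₂ φ).mp hφ))
  exact cor411i_restrict F₁ F₂ Ψ hF₁ hF₂ hiso hs.divSlim.1 hs.divSlim.2 h3.1.2.2.2.2.1 h3'.1.2.2.2.2.1 hdi hdi'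

end PreFrobenioid

end Literature.AlgebraicGeometry.Frobenioids
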